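import Summits.Ventures.LatticeQCDFlow.Exactness.ReversibleStickyTransfer
import Summits.Ventures.LatticeQCDFlow.Exactness.Phi4HMCMagnetisationTunnelling
import Summits.Ventures.LatticeQCDFlow.Exactness.Phi4HMCNoSpectralGapN
import HarnessLib

/-!
# HMC for lattice φ⁴ has no spectral gap — ABEL FORM, NO SUMMABILITY CAVEAT: `Σ_k ρ_{g_t}(k) rᵏ ≥ 1/(2(1 − r + ε))` for every `r < 1`, and every observable overlapping the far box is slow

HONEST FRAMING: exact (Metropolis-corrected) sampling algorithms for lattice gauge theory;
figures of merit are autocorrelation/cost numbers at stated couplings and volumes; no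
continuum-physics claim.  (SCALAR calibration rung S0-A: not a gauge result.)

Venture `LatticeQCDFlow` (cell pub-lqcd), topic `Exactness`; FANOUT row 2 (`s0-phi4`, HMC arm —
row 2's actual update `hmcOpPhi4 J λ δ N`, every `N ≥ 1`, `δ > 0`).  NEW WORK of the cell, composing
`Exactness/ReversibleStickyTransfer.lean` (the variational floor with a sticky indicator as trial
observable, Abel form) with gen-16's tail-rejection and indicator lemmas
(`Phi4HMCTailRejectionN.hmcPhi4_accept_le_of_mem_box`, `Phi4HMCNoSpectralGap.hmc_dirichlet_indicator_le`,
`integral_indicator_var`, `integral_boxInd_pos/le`).  Nothing is cited as a fact.  Printed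
counterparts NAMED ONLY: Livingstone–Betancourt–Byrne–Girolami 2019 Thm 5.13, Roberts–Tweedie 1996.

## Why this file

Gen-16's `hmcPhi4_no_spectral_gap` / `hmcPhi4_tauInt_unbounded` conclude `ρ(1) ≥ 1 − ε` and
"`τ_int ≥ 1/ε − ½` WHENEVER the autocorrelation series is summable and `ρ(1) < 1`" — a floor that
is vacuous exactly when the observable is worst (non-summable).  The Abel form below holds with NO
hypothesis on the series: for every `r < 1` the convergent sum `Σ_k ρ(k) rᵏ` is bounded below, so
either the series is not summable (infinite `τ_int`) or its sum — the limit `r ↑ 1`, by Abel — obeys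
the floor.  And the variational form transfers the stickiness of the far box to EVERY observable
that co-varies with it.

## What is proved (`Λ = Fin (n+1)`, `K = hmcOpPhi4 J λ δ N`, `χ_t` the indicator of
`A_t = {t ≤ φ_x ≤ 2t ∀x}`, `a_t = ⟨χ_t⟩`, `g_t = χ_t − a_t`, `ρ_t(k) = C_{g_t}(k)/C_{g_t}(0)`)

* **`hmcPhi4_abelSum_autocorr_ge`** — for every `ε > 0` there is `t ≥ 1` with `∫ g_t² e^{−S} > 0`
  and, for EVERY `0 ≤ r < 1`, **`Σ_{k≥0} ρ_t(k) rᵏ ≥ 1 / (2 (1 − r + ε))`** (no summability, no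
  `ρ(1) < 1`); letting `r ↑ 1`: the Abel-regularised `τ_int + ½` of `g_t` is `≥ 1/(2ε)`.
* **`hmcPhi4_tauInt_ge_of_box_overlap`** — CROSS-OBSERVABLE: if from every configuration of `A_t`
  (`t > 0`) the update is accepted with probability `≤ ε`, then every `g ∈ PolyObs` (e.g.
  `M − ⟨M⟩`, `S − ⟨S⟩`) with a summable autocorrelation series has
  **`τ_int(g) ≥ ⟨g (χ_t − a_t)⟩² / (⟨g²⟩ · ε ⟨χ_t⟩) − ½`**.

Reading (no numerics implied): the obstruction is structural (tail boxes of tiny mass), as in gen-16;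
what is new is that it no longer hides behind the summability hypothesis, and that it is inherited,
in proportion to the squared covariance with the box, by every polynomial observable.  NOT CLAIMED:
that `M` or `S` overlap the far box appreciably at simulated parameters (they do not: `⟨χ_t⟩ ≈
e^{−λVt⁴}`); the pqp integrator; `λ = 0`.
-/

namespace Summit.Ventures.LatticeQCDFlow.Exactness

open Real MeasureTheory Filter Finset
open Summit.Ventures.LatticeQCDFlow.Scoring

section NoGapAbel

variable {n : ℕ}

/-- **HMC FOR LATTICE φ⁴: NO SPECTRAL GAP, ABEL FORM (every `N ≥ 1`, `δ > 0`, `λ > 0`, real `J`).**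
For every `ε > 0` there is `t ≥ 1` such that the centred indicator `g_t = χ_t − ⟨χ_t⟩` of the box
`A_t = {t ≤ φ_x ≤ 2t ∀x}` has `∫ g_t² e^{−S} > 0` and, for every `0 ≤ r < 1`,
`Σ_{k≥0} ρ_{g_t}(k) rᵏ ≥ 1 / (2 (1 − r + ε))` — with no summability and no `ρ(1) < 1` hypothesis. -/
theorem hmcPhi4_abelSum_autocorr_ge {lam δ : ℝ} (hlam : 0 < lam) (hδ : 0 < δ)
    (J : Fin (n + 1) → Fin (n + 1) → ℝ) (N : ℕ) (hN : 1 ≤ N) {ε : ℝ} (hε : 0 < ε) :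
    ∃ t : ℝ, 1 ≤ t ∧
      0 < ∫ φ, ((if (∀ x, t ≤ φ x ∧ φ x ≤ 2 * t) then (1 : ℝ) else 0)
          - gibbsExpect J lam (fun ψ => if (∀ x, t ≤ ψ x ∧ ψ x ≤ 2 * t) then (1 : ℝ) else 0)) ^ 2
          * gibbsWeight J lam φ ∧
      ∀ r : ℝ, 0 ≤ r → r < 1 →
        1 / (2 * (1 - r + ε))
          ≤ ∑' k, (∫ φ, ((if (∀ x, t ≤ φ x ∧ φ x ≤ 2 * t) then (1 : ℝ) else 0)
              - gibbsExpect J lam (fun ψ => if (∀ x, t ≤ ψ x ∧ ψ x ≤ 2 * t) then (1 : ℝ) else 0))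
            * ((hmcOpPhi4 J lam δ N)^[k] (fun ψ => (if (∀ x, t ≤ ψ x ∧ ψ x ≤ 2 * t) then (1 : ℝ) else 0)
              - gibbsExpect J lam (fun ψ => if (∀ x, t ≤ ψ x ∧ ψ x ≤ 2 * t) then (1 : ℝ) else 0))) φ
            * gibbsWeight J lam φ)
            / (∫ φ, ((if (∀ x, t ≤ φ x ∧ φ x ≤ 2 * t) then (1 : ℝ) else 0)
              - gibbsExpect J lam (fun ψ => if (∀ x, t ≤ ψ x ∧ ψ x ≤ 2 * t) then (1 : ℝ) else 0)) ^ 2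
              * gibbsWeight J lam φ) * r ^ k := by
  have hco := latticePhi4Action_coercive hlam J
  have hZ := gibbsZ_pos hlam J
  have hΨm := measurable_hmcProposal J lam δ N (Λ := Fin (n + 1))
  have hΨi := hmcProposal_involutive J lam δ N (Λ := Fin (n + 1))
  have hΨμ : MeasurePreserving (hmcProposal J lam δ N)
      ((volume : Measure (Fin (n + 1) → ℝ)).prod volume)
      ((volume : Measure (Fin (n + 1) → ℝ)).prod volume) := measurePreserving_hmcProposal J lam δ N
  -- second moment of `φ₀`, for Chebyshev
  set M₂ := ∫ φ : Fin (n + 1) → ℝ, φ 0 ^ 2 * gibbsWeight J lam φ with hM₂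
  have hM₂0 : 0 ≤ M₂ := integral_nonneg fun φ => mul_nonneg (sq_nonneg _) (gibbsWeight_pos J lam φ).le
  obtain ⟨t, htT, ht1, hacc⟩ := hmcPhi4_accept_le_of_mem_box hlam hδ J N hN hε (1 + 2 * M₂ / gibbsZ J lam)
  have ht0 : 0 < t := by linarith
  refine ⟨t, ht1, ?_⟩
  set χ : (Fin (n + 1) → ℝ) → ℝ := fun φ => if (∀ x, t ≤ φ x ∧ φ x ≤ 2 * t) then (1 : ℝ) else 0
    with hχdef
  have hχ : BddObs χ := boxInd_bddObs t
  have h01 : ∀ φ, χ φ = 0 ∨ χ φ = 1 := fun φ => by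
    rw [hχdef]; dsimp only; split_ifs
    · exact Or.inr rfl
    · exact Or.inl rfl
  set a := gibbsExpect J lam χ with ha
  set I := ∫ φ, χ φ * gibbsWeight J lam φ with hI
  have hIpos : 0 < I := integral_boxInd_pos hlam J ht0
  have hIle : I ≤ 1 / t ^ 2 * M₂ := integral_boxInd_le hlam J ht0
  have haI : a * gibbsZ J lam = I := by
    rw [ha, hI]; unfold gibbsExpect; exact div_mul_cancel₀ _ hZ.ne'
  have haZ : a * ∫ φ, gibbsWeight J lam φ = ∫ φ, χ φ * gibbsWeight J lam φ := by
    have h := haI; unfold gibbsZ at h; rw [h]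
  -- `a ≤ ½` by Chebyshev and the choice of `T₀`
  have ha0 : 0 < a := by rw [ha]; unfold gibbsExpect; exact div_pos hIpos hZ
  have hahalf : a ≤ 1 / 2 := by
    have ht2 : 2 * M₂ / gibbsZ J lam ≤ t ^ 2 := by nlinarith
    have h1 : 2 * M₂ ≤ t ^ 2 * gibbsZ J lam := by
      rw [div_le_iff₀ hZ] at ht2; linarith
    have h2 : I * t ^ 2 ≤ M₂ := by
      have := hIle
      rw [one_div, ← div_eq_inv_mul, le_div_iff₀ (by positivity)] at this
      linarith
    have h3 : a * gibbsZ J lam * t ^ 2 ≤ M₂ := by rw [haI]; exact h2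
    have ht2pos : 0 < t ^ 2 := by positivity
    nlinarith [mul_pos hZ ht2pos]
  have hP : ∫ φ, (χ φ - a) ^ 2 * gibbsWeight J lam φ = (1 - a) * I :=
    integral_indicator_var hlam J hχ h01
  have hPpos : 0 < (1 - a) * I := mul_pos (by linarith) hIpos
  have hacc' : ∀ φ, χ φ = 1 →
      (∫ p, involAccept (phi4HmcEnergy J lam) (hmcProposal J lam δ N) (φ, p) * momentumWeight p)
          / momentumZ n ≤ ε := by
    intro φ hφ
    refine hacc φ ?_
    by_contra hnot
    have : χ φ = 0 := by rw [hχdef]; dsimp only; rw [if_neg hnot]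
    rw [this] at hφ
    exact zero_ne_one hφ
  have hdir := hmc_dirichlet_indicator_le hlam J δ N hχ h01 hacc' a
  refine ⟨by rw [hP]; exact hPpos, fun r hr0 hr1 => ?_⟩
  have hself := RevOp.abelSum_autocorr_ge_indicator_self (μ := volume) (A := BddObs)
    (K := hmcOpOf J lam (hmcProposal J lam δ N)) (w := gibbsWeight J lam)
    (fun φ => (gibbsWeight_pos J lam φ).le) (bddObs_const 1)
    (fun f h hf hh => bddObs_integrable_mul_mul_gibbsWeight one_pos hco hf hh)
    (fun f h c hf hh => bddObs_add_mul hf hh c)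
    (fun f hf => bddObs_hmcOpOf J lam hΨm hf)
    (fun f h c hf hh x => hmcOpOf_add_mul_bddObs J lam hΨm hf hh c x)
    (fun f h hf hh => hmcOpOf_reversible_bddObs one_pos hco hΨm hΨi hΨμ hf hh)
    (fun f hf => hmcOpOf_contraction_bddObs one_pos hco hΨm hΨi hΨμ hf)
    hχ h01 haZ hIpos (by linarith) hε.le hdir hr0 hr1
  refine le_trans ?_ hself
  -- `1/(2(1 − r + ε)) ≤ (1 − a)/((1 − r)(1 − a) + rε)` since `1 − a ≥ ½`, `(1 − r)(1 − a) + rε ≤ 1 − r + ε`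
  have hden : 0 < (1 - r) * (1 - a) + r * ε := by
    have h1 : 0 < (1 - r) * (1 - a) := mul_pos (by linarith) (by linarith)
    nlinarith [mul_nonneg hr0 hε.le]
  rw [div_le_div_iff₀ (by nlinarith) hden]
  nlinarith [mul_nonneg hr0 hε.le, mul_nonneg (sub_nonneg.2 hr1.le) ha0.le,
    mul_nonneg (sub_nonneg.2 hr1.le) hε.le]

/-- **EVERY OBSERVABLE OVERLAPPING THE FAR BOX IS SLOW.**  `K = hmcOpPhi4 J λ δ N` (any `δ`, `N`),
`t > 0`, and suppose that from every configuration of `A_t = {t ≤ φ_x ≤ 2t ∀x}` the update is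
accepted with probability at most `ε` (`Phi4HMCTailRejectionN.hmcPhi4_accept_le_of_mem_box` provides
such `t` for every `ε > 0`).  Then every `g ∈ PolyObs` whose autocorrelation series is summable has
`τ_int(g) ≥ ⟨g (χ_t − ⟨χ_t⟩)⟩² / (⟨g²⟩ · ε ⟨χ_t⟩) − ½`. -/
theorem hmcPhi4_tauInt_ge_of_box_overlap {lam : ℝ} (hlam : 0 < lam)
    (J : Fin (n + 1) → Fin (n + 1) → ℝ) (δ : ℝ) (N : ℕ) {t ε : ℝ}
    (hacc : ∀ φ : Fin (n + 1) → ℝ, (∀ y, t ≤ φ y ∧ φ y ≤ 2 * t) →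
      (∫ p, involAccept (phi4HmcEnergy J lam) (hmcProposal J lam δ N) (φ, p) * momentumWeight p)
          / momentumZ n ≤ ε)
    {g : (Fin (n + 1) → ℝ) → ℝ} (hg : PolyObs g)
    (hs : Summable fun k => (∫ φ, g φ * ((hmcOpPhi4 J lam δ N)^[k + 1] g) φ * gibbsWeight J lam φ)
        / ∫ φ, g φ ^ 2 * gibbsWeight J lam φ) :
    gibbsExpect J lam (fun φ => g φ * ((if (∀ x, t ≤ φ x ∧ φ x ≤ 2 * t) then (1 : ℝ) else 0)
          - gibbsExpect J lam (fun ψ => if (∀ x, t ≤ ψ x ∧ ψ x ≤ 2 * t) then (1 : ℝ) else 0))) ^ 2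
        / (gibbsExpect J lam (fun φ => g φ ^ 2)
          * (ε * gibbsExpect J lam (fun φ => if (∀ x, t ≤ φ x ∧ φ x ≤ 2 * t) then (1 : ℝ) else 0)))
        - 1 / 2
      ≤ tauInt (fun k => (∫ φ, g φ * ((hmcOpPhi4 J lam δ N)^[k] g) φ * gibbsWeight J lam φ)
        / ∫ φ, g φ ^ 2 * gibbsWeight J lam φ) := by
  have hco := latticePhi4Action_coercive hlam J
  have hZ := gibbsZ_pos hlam J
  have hΨm := measurable_hmcProposal J lam δ N (Λ := Fin (n + 1))
  have hΨi := hmcProposal_involutive J lam δ N (Λ := Fin (n + 1))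
  have hΨμ : MeasurePreserving (hmcProposal J lam δ N)
      ((volume : Measure (Fin (n + 1) → ℝ)).prod volume)
      ((volume : Measure (Fin (n + 1) → ℝ)).prod volume) := measurePreserving_hmcProposal J lam δ N
  obtain ⟨C, hC1, hCg⟩ := hmcProposal_growth J lam δ N
  have hC : 0 ≤ C := zero_le_one.trans hC1
  set χ : (Fin (n + 1) → ℝ) → ℝ := fun φ => if (∀ x, t ≤ φ x ∧ φ x ≤ 2 * t) then (1 : ℝ) else 0
    with hχdef
  have hχb : BddObs χ := boxInd_bddObs t
  have hχ : PolyObs χ := polyObs_of_bddObs hχb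
  have h01 : ∀ φ, χ φ = 0 ∨ χ φ = 1 := fun φ => by
    rw [hχdef]; dsimp only; split_ifs
    · exact Or.inr rfl
    · exact Or.inl rfl
  have hacc' : ∀ φ, χ φ = 1 →
      (∫ p, involAccept (phi4HmcEnergy J lam) (hmcProposal J lam δ N) (φ, p) * momentumWeight p)
          / momentumZ n ≤ ε := by
    intro φ hφ
    refine hacc φ ?_
    by_contra hnot
    have : χ φ = 0 := by rw [hχdef]; dsimp only; rw [if_neg hnot]
    rw [this] at hφ
    exact zero_ne_one hφ
  have hdir := hmc_dirichlet_indicator_le hlam J δ N hχb h01 hacc' (gibbsExpect J lam χ)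
  have hfloor := RevOp.tauInt_ge_of_indicator_dirichlet_le (μ := volume) (A := PolyObs)
    (K := hmcOpOf J lam (hmcProposal J lam δ N)) (w := gibbsWeight J lam)
    (fun φ => (gibbsWeight_pos J lam φ).le) (polyObs_const 1)
    (fun f h hf hh => polyObs_integrable_mul_mul_gibbsWeight one_pos hco hf hh)
    (fun f h c hf hh => polyObs_add_mul hf hh c)
    (fun f hf => polyObs_hmcOpOf J lam hΨm hC hCg hf)
    (fun f h c hf hh x => hmcOpOf_add_mul_poly J lam hΨm hC hCg hf hh c x)
    (fun f h hf hh => hmc_reversible_poly one_pos hco hΨm hΨi hΨμ hf hh)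
    (fun f hf => hmcOpOf_contraction_poly one_pos hco hΨm hΨi hΨμ hC hCg hf)
    hχ (gibbsExpect J lam χ) hdir hg hs
  unfold gibbsExpect at hfloor ⊢
  beta_reduce
  rw [cross_floor_transfer hZ.ne']
  exact hfloor

end NoGapAbel

end Summit.Ventures.LatticeQCDFlow.Exactness
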